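/-
Copyright (c) 2026. All rights reserved.
Released under Apache 2.0 license as described in the file LICENSE.
-/
import Mathlib
import Summits.RiemannHypothesis.RiemannHypothesis.Theorems.HandoffLatticeTailDepth
import Summits.RiemannHypothesis.RiemannHypothesis.Theorems.HandoffLatticeNyman
import Literature.NumberTheory.LFunctions.MuentzFormulaStrip
import HarnessLib

/-!
# THEOREM P on THEOREM N's fibre: the infimum in `riemannHypothesis_iff_latticeTail_fibre` is never attained

`HANDOFF/prove-1` gen15, ATTEMPT-22 §11. gen14's THEOREM N (`HandoffLatticeNymanRH`,
`…NymanConverse`): RH ⟺ the lattice tails `latticeTail 2 (fibreFn c b)` of the inner step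
completions `fibreFn c b = 1_{(1/2,1]} + Σ_j c_j 1_{(0,b_j]}` (`0 < b_j ≤ 1/2`, `Σ c_j b_j = −1/2`)
have infimum `0`. THIS FILE: that infimum is NEVER ATTAINED — `latticeTail 2 (fibreFn c b) > 0`
for every admissible `(c, b)` (`latticeTail_fibreFn_pos`), by the abstract THEOREM P
(`dilationSum_not_ae_zero`): the step function is bounded, vanishes off `(0, 1]`, equals `1` on
`(1/2, 1]`, and satisfies MÜNTZ'S FORMULA on `Re s > 0` (its dilation sum `−Σ c_j{b_j/u} − …` is
bounded — gen14's `norm_dilationSum_fibreFn_le` — so the tree's abstract continuation theorem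
`mellin_tsum_comp_mul_nat_of_isBigO` applies with `b = 0`). RH-free; nothing here bears on RH
(it says the Nyman–Beurling distance is positive at every finite stage, in lattice coordinates).
-/

noncomputable section

set_option linter.dupNamespace false

open Complex MeasureTheory Set Filter Asymptotics
open Literature.NumberTheory.LFunctions

namespace Summit.RiemannHypothesis.RiemannHypothesis.Theorems

namespace LatticeUncertainty

/-! ## Müntz and THEOREM P from BOUNDEDNESS of the dilation sum alone -/

section Bounded

variable {lam : ℝ} {F : ℝ → ℂ}

/-- For `u ≤ 0` the dilation sum is empty. -/
theorem dilationSum_of_nonpos (hlam : 0 ≤ lam) {u : ℝ} (hu : u ≤ 0) : dilationSum lam F u = 0 := by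
  have : ⌊lam / u⌋₊ = 0 := Nat.floor_eq_zero.mpr (by
    have := div_nonpos_of_nonneg_of_nonpos hlam hu; linarith)
  rw [dilationSum, this, Finset.Icc_eq_empty (by norm_num), Finset.sum_empty]

/-- **Müntz's formula from boundedness.** If `F` is measurable, bounded, vanishes off `(0, λ]`
(`λ > 0`), and its dilation sum `θ_F` is BOUNDED, then `𝓜θ_F = ζ·𝓜F` on `Re s > 0`, `s ≠ 1`
(the tree's abstract continuation theorem `mellin_tsum_comp_mul_nat_of_isBigO` with `b = 0`).
This is the most general Müntz instance of the series: Lipschitz data, one-jump data and step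
data are the cases where a Riemann-sum estimate supplies the bound. -/
theorem mellin_dilationSum_eq_zeta_mul_of_bounded (hlam : 0 < lam) (hFm : Measurable F) {M B : ℝ}
    (hFb : ∀ x, ‖F x‖ ≤ M) (hFs : ∀ x, x ∉ Ioc 0 lam → F x = 0)
    (hθ : ∀ u, ‖dilationSum lam F u‖ ≤ B) {s : ℂ} (hs : 0 < s.re) (hs1 : s ≠ 1) :
    mellin (dilationSum lam F) s = riemannZeta s * mellin F s := by
  have hFs1 : ∀ x, x ∉ Icc 0 lam → F x = 0 := fun x hx ↦ hFs x fun h ↦ hx (Ioc_subset_Icc_self h)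
  have hFs' : ∀ x, lam < x → F x = 0 := fun x hx ↦ hFs x fun h ↦ not_lt.mpr h.2 hx
  have hFi : Integrable F := integrable_of_bdd_of_support hFm.aestronglyMeasurable hFb hFs1
  have hGm : Measurable (dilationSum lam F) := measurable_dilationSum hFm lam
  have hGs : ∀ u, u ∉ Icc 0 lam → dilationSum lam F u = 0 := by
    intro u hu
    rcases le_or_gt u 0 with h | h
    · exact dilationSum_of_nonpos hlam.le h
    · exact dilationSum_eq_zero_of_lt hlam.le (not_le.mp fun h2 ↦ hu ⟨h.le, h2⟩)
  have hGi : Integrable (dilationSum lam F) :=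
    integrable_of_bdd_of_support hGm.aestronglyMeasurable hθ hGs
  -- the `ℕ`-series form agrees with `dilationSum` everywhere
  have hG : (fun x : ℝ ↦ ∑' k : ℕ, F ((k + 1 : ℕ) * x)) = dilationSum lam F := by
    funext x
    rcases le_or_gt x 0 with hx | hx
    · rw [dilationSum_of_nonpos hlam.le hx]
      have h0 : ∀ k : ℕ, F ((k + 1 : ℕ) * x) = 0 := fun k ↦ hFs _ fun h ↦ by
        have : ((k + 1 : ℕ) : ℝ) * x ≤ 0 := mul_nonpos_of_nonneg_of_nonpos (by positivity) hx
        linarith [h.1]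
      calc ∑' k : ℕ, F ((k + 1 : ℕ) * x) = ∑' _ : ℕ, (0 : ℂ) := tsum_congr h0
        _ = 0 := tsum_zero
    · exact (dilationSum_eq_tsum_nat hFs' hx).symm
  have htopF : F =O[atTop] fun x : ℝ ↦ x ^ (-(s.re + 2)) := by
    have h0 : F =ᶠ[atTop] fun _ ↦ (0 : ℂ) := by
      filter_upwards [eventually_gt_atTop lam] with x hx; exact hFs' x hx
    exact (isBigO_zero _ _).congr' h0.symm EventuallyEq.rfl
  have htopG : dilationSum lam F =O[atTop] fun x : ℝ ↦ x ^ (-(s.re + 2)) := by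
    have h0 : dilationSum lam F =ᶠ[atTop] fun _ ↦ (0 : ℂ) := by
      filter_upwards [eventually_gt_atTop lam] with x hx
      exact hGs x fun h ↦ not_le.mpr hx h.2
    exact (isBigO_zero _ _).congr' h0.symm EventuallyEq.rfl
  have hM0 : 0 ≤ M := (norm_nonneg _).trans (hFb 0)
  have hbotF : F =O[nhdsWithin 0 (Ioi 0)] fun x : ℝ ↦ x ^ (-(0 : ℝ)) := by
    refine IsBigO.of_bound M (Eventually.of_forall fun x ↦ ?_)
    rw [neg_zero, Real.rpow_zero, norm_one, mul_one]; exact hFb x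
  have hbotG : dilationSum lam F =O[nhdsWithin 0 (Ioi 0)] fun x : ℝ ↦ x ^ (-(0 : ℝ)) := by
    refine IsBigO.of_bound B (Eventually.of_forall fun x ↦ ?_)
    rw [neg_zero, Real.rpow_zero, norm_one, mul_one]; exact hθ x
  have key := mellin_tsum_comp_mul_nat_of_isBigO (F := F) (a := s.re + 2) (b := 0) (by linarith)
    (hFi.locallyIntegrable.locallyIntegrableOn _) htopF hbotF
  rw [hG] at key
  exact key (hGi.locallyIntegrable.locallyIntegrableOn _) htopG hbotG hs (by linarith) hs1

/-- **THEOREM P from boundedness.** `F` measurable, bounded, vanishing off `(0, λ]`, not a.e.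
zero there, with BOUNDED dilation sum: then `0 < ∫_{(0,δ]} ‖θ_F‖²` for every `δ > 0`; in
particular `0 < latticeTail λ F` (`λ ≥ 1`). -/
theorem setIntegral_normSq_dilationSum_pos_of_bounded (hlam : 0 < lam) (hFm : Measurable F)
    {M B : ℝ} (hFb : ∀ x, ‖F x‖ ≤ M) (hFs : ∀ x, x ∉ Ioc 0 lam → F x = 0)
    (hθ : ∀ u, ‖dilationSum lam F u‖ ≤ B) (hne : ¬ ∀ᵐ x ∂(volume.restrict (Ioc 0 lam)), F x = 0)
    {δ : ℝ} (hδ : 0 < δ) : 0 < ∫ u in Ioc 0 δ, ‖dilationSum lam F u‖ ^ 2 := by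
  have hMuntz : ∀ s : ℂ, 0 < s.re → s.re < 1 →
      mellin (dilationSum lam F) s = riemannZeta s * mellin F s := fun s hs hs1 ↦
    mellin_dilationSum_eq_zeta_mul_of_bounded hlam hFm hFb hFs hθ hs
      fun h ↦ by rw [h, one_re] at hs1; exact lt_irrefl _ hs1
  have hP := dilationSum_not_ae_zero hlam hFm hFb hFs hMuntz hne hδ
  have hGi : IntegrableOn (fun u ↦ ‖dilationSum lam F u‖ ^ 2) (Ioc 0 δ) :=
    Measure.integrableOn_of_bounded (M := B ^ 2) (by simp)
      (((measurable_dilationSum hFm lam).norm).pow_const 2).aestronglyMeasurable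
      (Eventually.of_forall fun u ↦ by
        rw [Real.norm_of_nonneg (by positivity)]
        exact pow_le_pow_left₀ (norm_nonneg _) (hθ u) 2)
  by_contra hle
  have h0 : ∫ u in Ioc 0 δ, ‖dilationSum lam F u‖ ^ 2 = 0 :=
    le_antisymm (not_lt.mp hle) (integral_nonneg fun u ↦ by positivity)
  have hae := (setIntegral_eq_zero_iff_of_nonneg_ae (Eventually.of_forall fun u ↦ by positivity)
    hGi).mp h0
  apply hP
  have hae' : ∀ᵐ u ∂(volume.restrict (Ioo 0 δ)), ‖dilationSum lam F u‖ ^ 2 = 0 :=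
    ae_restrict_of_ae_restrict_of_subset Ioo_subset_Ioc_self hae
  filter_upwards [hae'] with u hu
  simpa using hu

end Bounded

variable {n : ℕ} (c : Fin n → ℂ) (b : Fin n → ℝ)

/-- The step piece is an indicator. -/
theorem piece_eq_indicator (β : ℝ) : piece β = (Ioc 0 β).indicator fun _ ↦ (1 : ℂ) := by
  funext x
  simp only [piece, indicator, mem_Ioc]

/-- The step piece is measurable. -/
theorem measurable_piece (β : ℝ) : Measurable (piece β) := by
  rw [piece_eq_indicator]; exact measurable_const.indicator measurableSet_Ioc

/-- The fibre function is measurable. -/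
theorem measurable_fibreFn : Measurable (fibreFn c b) := by
  unfold fibreFn
  exact ((measurable_piece 1).sub (measurable_piece _)).add
    (Finset.measurable_sum _ fun j _ ↦ (measurable_piece _).const_mul _)

/-- `‖1_{(0,β]}(x)‖ ≤ 1`. -/
theorem norm_piece_le (β x : ℝ) : ‖piece β x‖ ≤ 1 := by
  unfold piece; split_ifs <;> simp

/-- The piece is `1` on `(0, β]`. -/
theorem piece_of_pos {β x : ℝ} (h : 0 < x ∧ x ≤ β) : piece β x = 1 := if_pos h

/-- The piece is `0` off `(0, β]`. -/
theorem piece_of_not {β x : ℝ} (h : ¬ (0 < x ∧ x ≤ β)) : piece β x = 0 := if_neg h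

/-- `‖fibreFn c b x‖ ≤ 2 + Σ ‖c_j‖`. -/
theorem norm_fibreFn_le (x : ℝ) : ‖fibreFn c b x‖ ≤ 2 + ∑ j, ‖c j‖ := by
  unfold fibreFn
  calc ‖piece 1 x - piece (1 / 2) x + ∑ j, c j * piece (b j) x‖
      ≤ ‖piece 1 x - piece (1 / 2) x‖ + ‖∑ j, c j * piece (b j) x‖ := norm_add_le _ _
    _ ≤ (‖piece 1 x‖ + ‖piece (1 / 2) x‖) + ∑ j, ‖c j * piece (b j) x‖ :=
        add_le_add (norm_sub_le _ _) (norm_sum_le _ _)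
    _ ≤ (1 + 1) + ∑ j, ‖c j‖ := by
        gcongr with j _
        · exact norm_piece_le _ _
        · exact norm_piece_le _ _
        · rw [norm_mul]
          exact mul_le_of_le_one_right (norm_nonneg _) (norm_piece_le _ _)
    _ = 2 + ∑ j, ‖c j‖ := by norm_num

variable {c b}

/-- The fibre function vanishes off `(0, 1]` (for `b_j ≤ 1/2`). -/
theorem fibreFn_eq_zero_of_not_mem (hb : ∀ j, 0 < b j ∧ b j ≤ 1 / 2) {x : ℝ} (hx : x ∉ Ioc 0 1) :
    fibreFn c b x = 0 := by
  have h1 : ¬ (0 < x ∧ x ≤ 1) := fun h ↦ hx h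
  have h2 : ¬ (0 < x ∧ x ≤ 1 / 2) := fun h ↦ hx ⟨h.1, h.2.trans (by norm_num)⟩
  have h3 : ∀ j, ¬ (0 < x ∧ x ≤ b j) := fun j h ↦ hx ⟨h.1, h.2.trans ((hb j).2.trans (by norm_num))⟩
  unfold fibreFn
  rw [piece_of_not h1, piece_of_not h2, sub_self, zero_add]
  exact Finset.sum_eq_zero fun j _ ↦ by rw [piece_of_not (h3 j), mul_zero]

/-- The fibre function equals `1` on `(1/2, 1]`. -/
theorem fibreFn_eq_one (hb : ∀ j, 0 < b j ∧ b j ≤ 1 / 2) {x : ℝ} (hx : x ∈ Ioc (1 / 2) 1) :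
    fibreFn c b x = 1 := by
  have h1 : (0 < x ∧ x ≤ 1) := ⟨by linarith [hx.1], hx.2⟩
  have h2 : ¬ (0 < x ∧ x ≤ 1 / 2) := fun h ↦ not_lt.mpr h.2 hx.1
  have h3 : ∀ j, ¬ (0 < x ∧ x ≤ b j) := fun j h ↦ not_lt.mpr (h.2.trans (hb j).2) hx.1
  unfold fibreFn
  rw [piece_of_pos h1, piece_of_not h2, sub_zero, Finset.sum_eq_zero fun j _ ↦ by
    rw [piece_of_not (h3 j), mul_zero], add_zero]

/-- The dilation sum of `fibreFn` is bounded everywhere by `2 + Σ ‖c_j‖`. -/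
theorem norm_dilationSum_fibreFn_le' (hb : ∀ j, 0 < b j ∧ b j ≤ 1 / 2)
    (hmass : ∑ j, c j * (b j : ℂ) = -(1 / 2 : ℂ)) (u : ℝ) :
    ‖dilationSum 2 (fibreFn c b) u‖ ≤ 2 + ∑ j, ‖c j‖ := by
  rcases le_or_gt u 0 with hu | hu
  · rw [dilationSum_of_nonpos zero_le_two hu, norm_zero]; positivity
  · exact norm_dilationSum_fibreFn_le c b hb hmass hu

/-- **Müntz's formula for the fibre step functions** on `Re s > 0`, `s ≠ 1`. -/
theorem mellin_dilationSum_fibreFn (hb : ∀ j, 0 < b j ∧ b j ≤ 1 / 2)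
    (hmass : ∑ j, c j * (b j : ℂ) = -(1 / 2 : ℂ)) {s : ℂ} (hs : 0 < s.re) (hs1 : s ≠ 1) :
    mellin (dilationSum 2 (fibreFn c b)) s = riemannZeta s * mellin (fibreFn c b) s :=
  mellin_dilationSum_eq_zeta_mul_of_bounded two_pos (measurable_fibreFn c b) (norm_fibreFn_le c b)
    (fun x hx ↦ fibreFn_eq_zero_of_not_mem hb fun h ↦ hx ⟨h.1, h.2.trans (by norm_num)⟩)
    (norm_dilationSum_fibreFn_le' hb hmass) hs hs1

/-- **THEOREM P on the fibre of THEOREM N: the infimum is never attained.** For every admissible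
inner step completion, `latticeTail 2 (fibreFn c b) > 0`. With gen14's
`riemannHypothesis_iff_latticeTail_fibre` (RH ⟺ the infimum of these tails is `0`): the
infimum, if zero, is approached but never reached — RH-free. -/
theorem latticeTail_fibreFn_pos (hb : ∀ j, 0 < b j ∧ b j ≤ 1 / 2)
    (hmass : ∑ j, c j * (b j : ℂ) = -(1 / 2 : ℂ)) : 0 < latticeTail 2 (fibreFn c b) := by
  have hFs : ∀ x, x ∉ Ioc 0 2 → fibreFn c b x = 0 := fun x hx ↦
    fibreFn_eq_zero_of_not_mem hb fun h ↦ hx ⟨h.1, h.2.trans (by norm_num)⟩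
  -- `F = 1` on `(1/2, 1]`, so `F` is not a.e. zero on `(0, 2]`
  have hne : ¬ ∀ᵐ x ∂(volume.restrict (Ioc 0 2)), fibreFn c b x = 0 := by
    intro h
    have hnull : volume {x | ¬ (x ∈ Ioc (0 : ℝ) 2 → fibreFn c b x = 0)} = 0 :=
      ae_iff.mp ((ae_restrict_iff' measurableSet_Ioc).mp h)
    have hsub : Ioc (1 / 2 : ℝ) 1 ⊆ {x | ¬ (x ∈ Ioc (0 : ℝ) 2 → fibreFn c b x = 0)} := by
      intro x hx himp
      have := himp ⟨by linarith [hx.1], hx.2.trans (by norm_num)⟩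
      rw [fibreFn_eq_one hb hx] at this
      exact one_ne_zero this
    have := measure_mono_null hsub hnull
    rw [Real.volume_Ioc, ENNReal.ofReal_eq_zero] at this
    linarith
  exact setIntegral_normSq_dilationSum_pos_of_bounded two_pos (measurable_fibreFn c b)
    (norm_fibreFn_le c b) hFs (norm_dilationSum_fibreFn_le' hb hmass) hne one_half_pos

end LatticeUncertainty

end Summit.RiemannHypothesis.RiemannHypothesis.Theorems
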